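import Summits.AtomisticToContinuum.FouriersLaw.Theorems.OddSectorIrreversibilityOddCorrectorDecayBathLocality

/-!
# `OddCorrectorDecay` is false

Closing file (negative side) for item `stmt-AtomisticToContinuum-9139`: the support decl `OddCorrectorDecay` of
route `OddSectorIrreversibility` (sub-problem `FouriersLaw` of `AtomisticToContinuum`) is REFUTED.

`OddCorrectorDecay` asserts, for every admissible parameter point `(ω₂, lam, β, γ, T)` of the pinned anharmonic
chain with Langevin baths at the two ends, an `N`-UNIFORM bound
`∫₀^∞ ‖P_tJ - (P_tJ)∘Θ‖_{L²(μ_T)} dt ≤ C √M_N` on the momentum-odd part of the equilibrium forecast of the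
total current `J = ∑_i j_i` (`μ_T = e^{-H_N/T}dqdp`, `M_N = ‖J‖²_{L²(μ_T)}`, `Θ` the momentum reversal).
It is false at every admissible point, for a structural reason:
* ODD PERSISTENCE (`ClosedChainKoopman.odd_persistence_closedChain`, from the abstract Hilbert-space lemma
  `OddPersistence.odd_persistence_of_near`): the CLOSED chain's flow `φ_t` is a `μ_T`-preserving,
  `Θ`-reversible bijection, so any curve `a_t` that stays within `δ` of `J∘φ_t` in `L²(μ_T)` on `[0, t₀]` has
  `∫₀^{t₀} ‖a_t - a_t∘Θ‖ ≥ t₀ (√M_N/6 - 2δ)`;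
* BATH LOCALITY (`OddCorrectorBathLocality.bathLocality`): the open-chain forecast `P_tJ` IS such a curve —
  for every horizon `t₀` and `ε > 0` some `N` has `‖P_tJ - J∘φ_t‖² ≤ ε M_N` on `[0, t₀]` — because the baths
  act on two momenta only: pathwise Grönwall comparison of the open and the closed chain driven from the same
  Gibbs initial point, AM–GM with a free parameter, stationarity / Liouville / Brownian moments for the
  expectations, and the extensivity `M_N ≥ c (N - 2) μ_T(univ)` of the current norm;
* hence `t₀ √M_N / 12 ≤ C √M_N` for every `t₀` (`BathReduction.oddCorrectorDecay_false_of_bathLocality_at`),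
  absurd.
Classification: SUBSTANTIVE — the load-bearing claim (an `N`-uniform `L¹_t` decay of the odd sector driven by
boundary baths) contradicts the ballistic, norm-preserving transport of the momentum-odd current by the
deterministic bulk; no side condition repairs it (the refutation holds at EVERY admissible parameter point and
for every candidate constant `C`).
-/

noncomputable section

namespace Summit.AtomisticToContinuum.FouriersLaw.Theorems

open Summit.AtomisticToContinuum.FouriersLaw.Theses.OddSectorIrreversibility (OddCorrectorDecay)
open Summit.AtomisticToContinuum.FouriersLaw.Theorems.OddCorrectorBathLocality

/-- **`¬ OddCorrectorDecay` (refuted-substantive).** At the admissible parameter point `ω₂ = lam = β = γ = T = 1`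
bath locality holds (`OddCorrectorBathLocality.bathLocality`), and
`OddCorrectorBathLocality.oddCorrectorDecay_false_of_bathLocality_at` (odd persistence of the closed chain) turns
it into the failure of the crux's `N`-uniform bound. Witness: the equilibrium pinned FPU-β chain itself; no cheap
repair (the argument works at every admissible parameter point and defeats every constant `C`). [folklore] -/
theorem not_OddCorrectorDecay : ¬ OddCorrectorDecay :=
  oddCorrectorDecay_false_of_bathLocality_at (ω₂ := 1) (lam := 1) (β := 1) (γ := 1) (T := 1)
    one_pos one_pos one_pos one_pos one_pos
    (bathLocality one_pos one_pos zero_le_one zero_le_one one_pos)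

end Summit.AtomisticToContinuum.FouriersLaw.Theorems

end
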